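import Literature.Analysis.FluidPDE.CKNMorreyHolder
import Literature.Analysis.FluidPDE.CKNMorreyBootstrapDual
import HarnessLib

/-!
# Parabolic Morrey classes of bounded, slab-supported and `L^p_t L^∞_x` data

Analysis/FluidPDE support file (everything proved) in the decomposition of the named fact
`Literature.Analysis.FluidPDE.LemarieRieusset2016.lemma13_6_duhamel` (`CKNMorreyHolder.lean`:
Lemarié-Rieusset 2016, §13.9 Step 3 and the proof of Lemma 13.6, pp. 474–478): the data of the
localised Duhamel formula must be placed in the parabolic Morrey classes of
`LocalisedDuhamelData` (p. 478). Three elementary membership criteria on the whole space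
`ℝ × ℝ³` (`IsParabolicMorreyOn univ Φ p q`: `∫_{Q_r(z)} Φ^p ≤ M r^{5(1-p/q)}`):

* `isParabolicMorreyOn_univ_of_bounded_of_support` — bounded data supported in a fixed cylinder
  `Q_R(z₁)` belong to every class `ℳ₂^{p,q}`, `0 < p ≤ q`
  (`∫_{Q_r} Φ^p ≤ B^p |Q_r ∩ Q_R| ≤ C min(r⁵, 1) ≤ C r^{5(1-p/q)}`);
* `isParabolicMorreyOn_univ_of_le_time` — data dominated by a function of time alone,
  `Φ(s, x) ≤ h(s)` with `∫ h^p < ∞`, belong to `ℳ₂^{p, 5p/2}`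
  (`∫_{Q_r} Φ^p ≤ |B_r| ∫ h^p = C r³`, and `5(1 - p/(5p/2)) = 3`) — the class of the slot `γ`
  (`q₀ < 5q₀/2`, p. 478: "γ ∈ L^{q₀}_t L^∞_x");
* `isParabolicMorreyOn_univ_of_bounded_of_slab` — bounded data supported in a time slab with
  slices uniformly in `L^p_x` belong to `ℳ₂^{p,q}` whenever `0 ≤ 5(1-p/q) ≤ 5`... more precisely
  for every `q ≥ p` (`∫_{Q_r} Φ^p ≤ min(B^p|Q_r|, N(b-a)) ≤ C r^{5(1-p/q)}`) — the class of the
  slot `η`.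

## References

* P. G. Lemarié-Rieusset, *The Navier–Stokes Problem in the 21st Century*, CRC Press (2016),
  Lemma 13.6 p. 478, §13.8 p. 462. [LemarieRieusset2016]
-/

noncomputable section

open MeasureTheory Set Function Filter Metric Real
open scoped ENNReal NNReal Topology

namespace Literature.Analysis.FluidPDE

/-- Integrals of data vanishing off a set reduce to the intersection. [folklore] -/
theorem setLIntegral_eq_inter_of_eq_zero_off {Φ : ℝ × EuclideanSpace ℝ (Fin 3) → ℝ≥0∞}
    {T : Set (ℝ × EuclideanSpace ℝ (Fin 3))} (hT : MeasurableSet T) (hsupp : ∀ w, w ∉ T → Φ w = 0)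
    {p : ℝ} (hp : 0 < p) (S : Set (ℝ × EuclideanSpace ℝ (Fin 3))) :
    ∫⁻ w in S, Φ w ^ p = ∫⁻ w in S ∩ T, Φ w ^ p := by
  have h : (fun w => Φ w ^ p) = T.indicator fun w => Φ w ^ p := by
    funext w
    by_cases hw : w ∈ T
    · rw [indicator_of_mem hw]
    · rw [indicator_of_notMem hw, hsupp w hw, ENNReal.zero_rpow_of_pos hp]
  conv_lhs => rw [h]
  rw [lintegral_indicator hT, Measure.restrict_restrict hT, inter_comm]

/-- **Bounded data supported in a fixed cylinder belong to every parabolic Morrey class**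
`ℳ₂^{p,q}`, `0 < p ≤ q`. [folklore] -/
theorem isParabolicMorreyOn_univ_of_bounded_of_support {Φ : ℝ × EuclideanSpace ℝ (Fin 3) → ℝ≥0∞}
    {B : ℝ≥0} (hΦ : ∀ w, Φ w ≤ B) {R : ℝ} {z₁ : ℝ × EuclideanSpace ℝ (Fin 3)}
    (hsupp : ∀ w, w ∉ FluidPDE.parabolicCylinderCentered R z₁ → Φ w = 0) {p q : ℝ} (hp : 0 < p)
    (hpq : p ≤ q) : IsParabolicMorreyOn univ Φ p q := by
  rw [isParabolicMorreyOn_univ_iff]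
  have hq : 0 < q := hp.trans_le hpq
  have hβ0 : 0 ≤ 5 * (1 - p / q) := by
    have : p / q ≤ 1 := (div_le_one hq).2 hpq
    nlinarith
  have hβ5 : 5 * (1 - p / q) ≤ 5 := by
    have : 0 ≤ p / q := div_nonneg hp.le hq.le
    nlinarith
  obtain ⟨V, hV⟩ := volume_inter_cylinders_le_rpow hβ0 hβ5 R z₁
  have hmeas : MeasurableSet (FluidPDE.parabolicCylinderCentered R z₁) :=
    (FluidPDE.isOpen_parabolicCylinderCentered R z₁).measurableSet
  refine ⟨B ^ p * V, fun z r hr => ?_⟩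
  calc ∫⁻ w in FluidPDE.parabolicCylinderCentered r z, Φ w ^ p
      = ∫⁻ w in FluidPDE.parabolicCylinderCentered r z ∩ FluidPDE.parabolicCylinderCentered R z₁, Φ w ^ p :=
        setLIntegral_eq_inter_of_eq_zero_off hmeas hsupp hp _
    _ ≤ ∫⁻ _ in FluidPDE.parabolicCylinderCentered r z ∩ FluidPDE.parabolicCylinderCentered R z₁,
          (B : ℝ≥0∞) ^ p := lintegral_mono fun w => ENNReal.rpow_le_rpow (hΦ w) hp.le
    _ = (B : ℝ≥0∞) ^ p * volume (FluidPDE.parabolicCylinderCentered r z ∩ FluidPDE.parabolicCylinderCentered R z₁) :=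
        setLIntegral_const _ _
    _ ≤ (B : ℝ≥0∞) ^ p * (V * ENNReal.ofReal (r ^ (5 * (1 - p / q)))) := by
        gcongr
        exact hV z r hr
    _ = ((B ^ p * V : ℝ≥0) : ℝ≥0∞) * ENNReal.ofReal (r ^ (5 * (1 - p / q))) := by
        rw [ENNReal.coe_mul, ENNReal.coe_rpow_of_nonneg _ hp.le, mul_assoc]

/-- **Data dominated by an `L^p` function of time alone belong to `ℳ₂^{p, 5p/2}`**:
if `Φ(s, x) ≤ h(s)` with `h` measurable, `∫ h^p < ∞`, `p > 0`, then
`∫_{Q_r(z)} Φ^p ≤ |B₁| ‖h^p‖₁ r³`. [folklore] -/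
theorem isParabolicMorreyOn_univ_of_le_time {Φ : ℝ × EuclideanSpace ℝ (Fin 3) → ℝ≥0∞} {h : ℝ → ℝ≥0∞}
    (hh : Measurable h) (hΦ : ∀ s x, Φ (s, x) ≤ h s) {p : ℝ} (hp : 0 < p)
    (hfin : ∫⁻ s, h s ^ p < ∞) : IsParabolicMorreyOn univ Φ p (5 * p / 2) := by
  rw [isParabolicMorreyOn_univ_iff]
  have hexp : 5 * (1 - p / (5 * p / 2)) = 3 := by
    field_simp
    norm_num
  set N : ℝ≥0∞ := ∫⁻ s, h s ^ p with hN
  have hB1 : volume (ball (0 : EuclideanSpace ℝ (Fin 3)) 1) < ∞ := measure_ball_lt_top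
  refine ⟨(N * volume (ball (0 : EuclideanSpace ℝ (Fin 3)) 1)).toNNReal, fun z r hr => ?_⟩
  rw [ENNReal.coe_toNNReal (ENNReal.mul_ne_top hfin.ne hB1.ne), hexp]
  have hball : volume (ball z.2 r) = ENNReal.ofReal (r ^ 3) * volume (ball (0 : EuclideanSpace ℝ (Fin 3)) 1) := by
    rw [Measure.addHaar_ball_of_pos volume z.2 hr, finrank_euclideanSpace_three]
  calc ∫⁻ w in FluidPDE.parabolicCylinderCentered r z, Φ w ^ p
      ≤ ∫⁻ w in FluidPDE.parabolicCylinderCentered r z, h w.1 ^ p :=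
        lintegral_mono fun w => ENNReal.rpow_le_rpow (hΦ w.1 w.2) hp.le
    _ = (∫⁻ s in Ioo (z.1 - r ^ 2) (z.1 + r ^ 2), h s ^ p) * volume (ball z.2 r) := by
        rw [FluidPDE.parabolicCylinderCentered, Measure.volume_eq_prod, ← Measure.prod_restrict]
        have hfg : (fun w : ℝ × EuclideanSpace ℝ (Fin 3) => h w.1 ^ p) =
            fun w => (fun s => h s ^ p) w.1 * (fun _ : EuclideanSpace ℝ (Fin 3) => (1 : ℝ≥0∞)) w.2 := by
          funext w; simp
        rw [hfg, lintegral_prod_mul (hh.pow_const p).aemeasurable aemeasurable_const]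
        simp
    _ ≤ N * volume (ball z.2 r) := by
        gcongr
        exact setLIntegral_le_lintegral _ _
    _ = N * volume (ball (0 : EuclideanSpace ℝ (Fin 3)) 1) * ENNReal.ofReal (r ^ (3 : ℝ)) := by
        rw [hball, show (3 : ℝ) = ((3 : ℕ) : ℝ) by norm_num, Real.rpow_natCast]
        ring

/-- **Bounded data supported in a time slab with slices uniformly in `L^p_x` belong to
`ℳ₂^{p,q}` for every `q ≥ p > 0`**: `∫_{Q_r} Φ^p ≤ min (B^p |Q_r|, (b - a) N) ≤ C r^{5(1-p/q)}`
(`r ≤ 1`, `r ≥ 1`). [folklore] -/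
theorem isParabolicMorreyOn_univ_of_bounded_of_slab {Φ : ℝ × EuclideanSpace ℝ (Fin 3) → ℝ≥0∞}
    (hΦm : Measurable Φ) {B : ℝ≥0} (hB : ∀ w, Φ w ≤ B) {N : ℝ≥0} {p : ℝ} (hp : 0 < p)
    (hN : ∀ s, ∫⁻ x, Φ (s, x) ^ p ≤ N) {a b : ℝ}
    (hslab : ∀ w : ℝ × EuclideanSpace ℝ (Fin 3), w.1 ∉ Ioo a b → Φ w = 0) {q : ℝ} (hpq : p ≤ q) :
    IsParabolicMorreyOn univ Φ p q := by
  rw [isParabolicMorreyOn_univ_iff]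
  have hq : 0 < q := hp.trans_le hpq
  set β : ℝ := 5 * (1 - p / q) with hβ
  have hβ0 : 0 ≤ β := by
    have : p / q ≤ 1 := (div_le_one hq).2 hpq
    rw [hβ]; nlinarith
  have hβ5 : β ≤ 5 := by
    have : 0 ≤ p / q := div_nonneg hp.le hq.le
    rw [hβ]; nlinarith
  have hB1 : volume (ball (0 : EuclideanSpace ℝ (Fin 3)) 1) < ∞ := measure_ball_lt_top
  -- the two bounds
  have bound1 : ∀ (z : ℝ × EuclideanSpace ℝ (Fin 3)) (r : ℝ), 0 < r →
      ∫⁻ w in FluidPDE.parabolicCylinderCentered r z, Φ w ^ p ≤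
        (B : ℝ≥0∞) ^ p * (ENNReal.ofReal (2 * r ^ 5) * volume (ball (0 : EuclideanSpace ℝ (Fin 3)) 1)) := by
    intro z r hr
    calc ∫⁻ w in FluidPDE.parabolicCylinderCentered r z, Φ w ^ p
        ≤ ∫⁻ _ in FluidPDE.parabolicCylinderCentered r z, (B : ℝ≥0∞) ^ p :=
          lintegral_mono fun w => ENNReal.rpow_le_rpow (hB w) hp.le
      _ = (B : ℝ≥0∞) ^ p * volume (FluidPDE.parabolicCylinderCentered r z) := setLIntegral_const _ _
      _ = _ := by rw [volume_parabolicCylinderCentered hr z]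
  have bound2 : ∀ (z : ℝ × EuclideanSpace ℝ (Fin 3)) (r : ℝ),
      ∫⁻ w in FluidPDE.parabolicCylinderCentered r z, Φ w ^ p ≤ ENNReal.ofReal (b - a) * N := by
    intro z r
    have hT : MeasurableSet (Ioo a b ×ˢ (univ : Set (EuclideanSpace ℝ (Fin 3)))) :=
      measurableSet_Ioo.prod MeasurableSet.univ
    have hsupp : ∀ w : ℝ × EuclideanSpace ℝ (Fin 3), w ∉ Ioo a b ×ˢ (univ : Set (EuclideanSpace ℝ (Fin 3))) →
        Φ w = 0 := fun w hw => hslab w (by simpa using hw)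
    calc ∫⁻ w in FluidPDE.parabolicCylinderCentered r z, Φ w ^ p
        ≤ ∫⁻ w, Φ w ^ p := setLIntegral_le_lintegral _ _
      _ = ∫⁻ w in univ ∩ Ioo a b ×ˢ (univ : Set (EuclideanSpace ℝ (Fin 3))), Φ w ^ p := by
          rw [← setLIntegral_univ, setLIntegral_eq_inter_of_eq_zero_off hT hsupp hp univ]
      _ = ∫⁻ s in Ioo a b, ∫⁻ x, Φ (s, x) ^ p := by
          rw [univ_inter, Measure.volume_eq_prod, ← Measure.restrict_univ (μ := (volume : Measure (EuclideanSpace ℝ (Fin 3)))),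
            ← Measure.prod_restrict, Measure.restrict_univ, lintegral_prod]
          exact ((hΦm.pow_const p).comp measurable_id).aemeasurable
      _ ≤ ∫⁻ _ in Ioo a b, (N : ℝ≥0∞) := lintegral_mono fun s => hN s
      _ = ENNReal.ofReal (b - a) * N := by
          rw [setLIntegral_const, Real.volume_Ioo, mul_comm]
  refine ⟨((B : ℝ≥0∞) ^ p * (2 * volume (ball (0 : EuclideanSpace ℝ (Fin 3)) 1)) +
      ENNReal.ofReal (b - a) * N).toNNReal, fun z r hr => ?_⟩
  have hfin1 : (B : ℝ≥0∞) ^ p * (2 * volume (ball (0 : EuclideanSpace ℝ (Fin 3)) 1)) ≠ ∞ :=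
    ENNReal.mul_ne_top (ENNReal.rpow_ne_top_of_nonneg hp.le ENNReal.coe_ne_top)
      (ENNReal.mul_ne_top (by simp) hB1.ne)
  have hfin2 : ENNReal.ofReal (b - a) * N ≠ ∞ := ENNReal.mul_ne_top ENNReal.ofReal_ne_top ENNReal.coe_ne_top
  rw [ENNReal.coe_toNNReal (ENNReal.add_ne_top.2 ⟨hfin1, hfin2⟩)]
  rcases le_or_gt r 1 with hr1 | hr1
  · -- `r ≤ 1`: `r⁵ ≤ r^β`
    have h5 : r ^ (5 : ℕ) ≤ r ^ β := by
      calc r ^ (5 : ℕ) = r ^ (5 : ℝ) := by rw [← Real.rpow_natCast]; norm_num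
        _ ≤ r ^ β := Real.rpow_le_rpow_of_exponent_ge hr hr1 hβ5
    calc ∫⁻ w in FluidPDE.parabolicCylinderCentered r z, Φ w ^ p
        ≤ (B : ℝ≥0∞) ^ p * (ENNReal.ofReal (2 * r ^ 5) * volume (ball (0 : EuclideanSpace ℝ (Fin 3)) 1)) :=
          bound1 z r hr
      _ ≤ (B : ℝ≥0∞) ^ p * (ENNReal.ofReal (2 * r ^ β) * volume (ball (0 : EuclideanSpace ℝ (Fin 3)) 1)) := by
          gcongr
      _ = (B : ℝ≥0∞) ^ p * (2 * volume (ball (0 : EuclideanSpace ℝ (Fin 3)) 1)) * ENNReal.ofReal (r ^ β) := by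
          rw [ENNReal.ofReal_mul (by norm_num), ENNReal.ofReal_ofNat]; ring
      _ ≤ _ := by
          gcongr
          exact le_self_add
  · -- `r > 1`: `1 ≤ r^β`
    have h1 : (1 : ℝ≥0∞) ≤ ENNReal.ofReal (r ^ β) :=
      ENNReal.one_le_ofReal.2 (Real.one_le_rpow hr1.le hβ0)
    calc ∫⁻ w in FluidPDE.parabolicCylinderCentered r z, Φ w ^ p
        ≤ ENNReal.ofReal (b - a) * N := bound2 z r
      _ ≤ ((B : ℝ≥0∞) ^ p * (2 * volume (ball (0 : EuclideanSpace ℝ (Fin 3)) 1)) +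
            ENNReal.ofReal (b - a) * N) * 1 := by rw [mul_one]; exact le_add_self
      _ ≤ _ := mul_le_mul' le_rfl h1

end Literature.Analysis.FluidPDE
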